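import Mathlib

/-!
# Tier4/Line1/JacobsonBlock — the pure-algebra rung (C1) + (C2) ⇒ (C3): a block-semisimple algebra realises every
block-diagonal endomorphism (Schur + Jacobson density)

Blind re-derivation cell `pub-hodge-repro`, Tier 4 (README §9–§10), seat t4-L1-p1 (gen 3).  Target tree path
`lean/Summits/Ventures/HodgeRepro/Tier4/Line1/JacobsonBlock.lean`.  Mathlib only.

WHAT THIS IS.  The anatomy note (proofs/t4/L1/I4-anatomy-t4-L1-p1.md §2) names three facts of admissibility theory
behind the RTF half of (S3″): (C1) the `K`-fixed part of each constituent is a SIMPLE module over the Hecke algebra,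
(C2) distinct constituents give NON-ISOMORPHIC modules, (C3) the Hecke algebra then realises every block-diagonal
operator (Jacobson density).  This file proves (C1) ∧ (C2) ⇒ (C3) in the abstract: for a ℂ-algebra `R`, a
finite-dimensional `R`-module `V` (ℂ acting through `R`), and a family of `R`-submodules `W i` with `R`-linear
projections `π i` (`V = ⨁ᵢ W i`, encoded by `hπmem`, `hπsum`, `hπid`, `hπzero`) that are simple and pairwise
non-isomorphic, every family `T i : Module.End ℂ (W i)` is realised by ONE element of `R`:
`∃ r : R, ∀ i, ∀ w (hw : w ∈ W i), r • w = T i ⟨w, hw⟩` (`blockAlgebra_realises`).  Steps: Schur over ℂ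
(`Module.End.exists_eigenvalue` + simplicity: every `R`-endomorphism of a block is a scalar,
`schur_scalar_of_isSimpleModule`); non-isomorphism ⇒ every `R`-endomorphism of `V` preserves the blocks
(`proj_apply_eq_zero_of_ne`, `apply_mem_of_mem`); hence the block-diagonal `T` commutes with `Module.End R V`
(`blockMap_comm`); Mathlib's `jacobson_density` on a ℂ-basis and ℂ-linearity give `r`.  The consumer (t4-L1-p5's (D),
`HeckeIsolation`) instantiates `R` by the algebra of bi-`K`-invariant test functions acting through `R f` on the finite
`K`-block, `W m` by the `K`-fixed admissible part of `τ m`, `π m` by the isotypic projections; (C1) and (C2) stay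
DISPLAYED there — nothing here says they hold.  Nothing here says anything about the status of the Hodge conjecture
for CM abelian varieties, which is NOT proved (HC_CM is NOT proved by anyone in this repository).
-/

set_option autoImplicit false

noncomputable section

namespace Summit.Ventures.HodgeRepro.Tier4.Line1

open Module

namespace JacobsonBlock

section Schur

variable {R : Type} [Ring R] [Algebra ℂ R]

/-- **Schur over ℂ**: an `R`-endomorphism of a finite-dimensional simple `R`-module (ℂ acting through `R`) is a
scalar. -/
theorem schur_scalar_of_isSimpleModule {W : Type} [AddCommGroup W] [Module ℂ W] [Module R W] [IsScalarTower ℂ R W]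
    [FiniteDimensional ℂ W] [IsSimpleModule R W] (φ : W →ₗ[R] W) : ∃ c : ℂ, ∀ w, φ w = c • w := by
  haveI : Nontrivial W := IsSimpleModule.nontrivial R W
  let φℂ : Module.End ℂ W := φ.restrictScalars ℂ
  obtain ⟨c, hc⟩ := Module.End.exists_eigenvalue φℂ
  let E : Submodule R W :=
    { carrier := {w | φ w = c • w}
      add_mem' := by
        intro a b ha hb
        simp only [Set.mem_setOf_eq] at ha hb ⊢
        rw [map_add, ha, hb, smul_add]
      zero_mem' := by simp
      smul_mem' := by
        intro r w hw
        simp only [Set.mem_setOf_eq] at hw ⊢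
        rw [map_smul, hw, smul_comm] }
  have hE : E ≠ ⊥ := by
    obtain ⟨w, hw⟩ := hc.exists_hasEigenvector
    intro h
    have hwE : w ∈ E := by
      show φ w = c • w
      exact hw.apply_eq_smul
    rw [h, Submodule.mem_bot] at hwE
    exact hw.2 hwE
  have hE' : E = ⊤ := (eq_bot_or_eq_top E).resolve_left hE
  refine ⟨c, fun w => ?_⟩
  have : w ∈ E := by rw [hE']; trivial
  exact this

end Schur

section Blocks

variable {R : Type} [Ring R] [Algebra ℂ R] {V : Type} [AddCommGroup V] [Module ℂ V] [Module R V]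
  [IsScalarTower ℂ R V] [FiniteDimensional ℂ V] {ι : Type} [Fintype ι] [DecidableEq ι]
  (W : ι → Submodule R V) (π : ι → V →ₗ[R] V)

omit [Algebra ℂ R] [Module ℂ V] [IsScalarTower ℂ R V] [FiniteDimensional ℂ V] [Fintype ι] [DecidableEq ι] in
/-- **the blocks are preserved by every `R`-endomorphism**: the `j`-component of `φ w`, `w ∈ W i`, `i ≠ j`, vanishes —
Schur's lemma between non-isomorphic simple modules. -/
theorem proj_apply_eq_zero_of_ne [∀ i, IsSimpleModule R (W i)] (hπmem : ∀ i v, π i v ∈ W i)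
    (hnon : ∀ i j, i ≠ j → IsEmpty ((W i) ≃ₗ[R] (W j))) (φ : V →ₗ[R] V) {i j : ι} (hij : i ≠ j) {w : V}
    (hw : w ∈ W i) : π j (φ w) = 0 := by
  let ψ : W i →ₗ[R] W j := LinearMap.codRestrict (W j) ((π j) ∘ₗ φ ∘ₗ (W i).subtype) fun v => hπmem j _
  rcases LinearMap.bijective_or_eq_zero ψ with hbij | hzero
  · exact ((hnon i j hij).false (LinearEquiv.ofBijective ψ hbij)).elim
  · have := congrArg Subtype.val (LinearMap.congr_fun hzero ⟨w, hw⟩)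
    simpa [ψ] using this

omit [Algebra ℂ R] [Module ℂ V] [IsScalarTower ℂ R V] [FiniteDimensional ℂ V] [DecidableEq ι] in
/-- an `R`-endomorphism maps each block into itself. -/
theorem apply_mem_of_mem [∀ i, IsSimpleModule R (W i)] (hπmem : ∀ i v, π i v ∈ W i) (hπsum : ∀ v, ∑ i, π i v = v)
    (hnon : ∀ i j, i ≠ j → IsEmpty ((W i) ≃ₗ[R] (W j))) (φ : V →ₗ[R] V) {i : ι} {w : V} (hw : w ∈ W i) :
    φ w ∈ W i := by
  have h : φ w = π i (φ w) := by
    conv_lhs => rw [← hπsum (φ w)]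
    rw [Finset.sum_eq_single i]
    · intro j _ hj
      exact proj_apply_eq_zero_of_ne W π hπmem hnon φ (Ne.symm hj) hw
    · intro h
      exact absurd (Finset.mem_univ i) h
  rw [h]
  exact hπmem i _

omit [Algebra ℂ R] [Module ℂ V] [IsScalarTower ℂ R V] [FiniteDimensional ℂ V] [DecidableEq ι] in
/-- the projection of `φ w` onto its own block, `w ∈ W i`, is `φ w` itself. -/
theorem proj_apply_of_mem [∀ i, IsSimpleModule R (W i)] (hπmem : ∀ i v, π i v ∈ W i) (hπsum : ∀ v, ∑ i, π i v = v)
    (hπid : ∀ i, ∀ w ∈ W i, π i w = w) (hnon : ∀ i j, i ≠ j → IsEmpty ((W i) ≃ₗ[R] (W j))) (φ : V →ₗ[R] V)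
    {i : ι} {w : V} (hw : w ∈ W i) : π i (φ w) = φ w :=
  hπid i _ (apply_mem_of_mem W π hπmem hπsum hnon φ hw)

/-- **the block-diagonal map** assembled from `T i : Module.End ℂ (W i)` and the projections, as a ℂ-linear map. -/
def blockMap (hπmem : ∀ i v, π i v ∈ W i) (T : ∀ i, Module.End ℂ (W i)) : V →ₗ[ℂ] V :=
  ∑ i, ((W i).subtype.restrictScalars ℂ) ∘ₗ (T i) ∘ₗ
    ((LinearMap.codRestrict (W i) (π i) (hπmem i)).restrictScalars ℂ)

omit [FiniteDimensional ℂ V] [DecidableEq ι] in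
/-- the block-diagonal map evaluated: `∑ i, T i (π i v)`. -/
theorem blockMap_apply (hπmem : ∀ i v, π i v ∈ W i) (T : ∀ i, Module.End ℂ (W i)) (v : V) :
    blockMap W π hπmem T v = ∑ i, (T i ⟨π i v, hπmem i v⟩ : V) := by
  simp only [blockMap, LinearMap.sum_apply, LinearMap.comp_apply, LinearMap.restrictScalars_apply,
    Submodule.subtype_apply]
  rfl

omit [FiniteDimensional ℂ V] [DecidableEq ι] in
/-- on a block the block-diagonal map is `T i`. -/
theorem blockMap_apply_of_mem (hπmem : ∀ i v, π i v ∈ W i) (hπid : ∀ i, ∀ w ∈ W i, π i w = w)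
    (hπzero : ∀ i j, i ≠ j → ∀ w ∈ W j, π i w = 0) (T : ∀ i, Module.End ℂ (W i)) {i : ι} {w : V} (hw : w ∈ W i) :
    blockMap W π hπmem T w = (T i ⟨w, hw⟩ : V) := by
  rw [blockMap_apply, Finset.sum_eq_single i]
  · congr 2
    exact Subtype.ext (hπid i w hw)
  · intro j _ hj
    have h0 : π j w = 0 := hπzero j i hj w hw
    have : (⟨π j w, hπmem j w⟩ : W j) = 0 := Subtype.ext h0
    rw [this, map_zero, Submodule.coe_zero]
  · intro h
    exact absurd (Finset.mem_univ i) h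

omit [DecidableEq ι] in
/-- **the block-diagonal map commutes with every `R`-endomorphism** (Schur: `φ` is a scalar on each block). -/
theorem blockMap_comm [∀ i, IsSimpleModule R (W i)] (hπmem : ∀ i v, π i v ∈ W i) (hπsum : ∀ v, ∑ i, π i v = v)
    (hπid : ∀ i, ∀ w ∈ W i, π i w = w)
    (hnon : ∀ i j, i ≠ j → IsEmpty ((W i) ≃ₗ[R] (W j))) (T : ∀ i, Module.End ℂ (W i)) (φ : V →ₗ[R] V) (v : V) :
    blockMap W π hπmem T (φ v) = φ (blockMap W π hπmem T v) := by
  haveI : ∀ i, FiniteDimensional ℂ (W i) := fun i =>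
    FiniteDimensional.of_injective ((W i).subtype.restrictScalars ℂ) Subtype.val_injective
  rw [blockMap_apply, blockMap_apply, map_sum]
  refine Finset.sum_congr rfl fun i _ => ?_
  -- `φ` restricted to the block `W i` is a scalar `c`
  let φi : W i →ₗ[R] W i :=
    LinearMap.codRestrict (W i) (φ ∘ₗ (W i).subtype) fun x => apply_mem_of_mem W π hπmem hπsum hnon φ x.2
  obtain ⟨c, hc⟩ := schur_scalar_of_isSimpleModule φi
  have hφ : ∀ w (hw : w ∈ W i), φ w = c • w := by
    intro w hw
    have := congrArg Subtype.val (hc ⟨w, hw⟩)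
    simpa [φi] using this
  -- `π i (φ v) = c • π i v`
  have hπφ : π i (φ v) = c • π i v := by
    have h1 : π i (φ v) = π i (φ (π i v)) := by
      conv_lhs => rw [← hπsum v]
      rw [map_sum, map_sum, Finset.sum_eq_single i]
      · intro j _ hj
        exact proj_apply_eq_zero_of_ne W π hπmem hnon φ hj (hπmem j v)
      · intro h
        exact absurd (Finset.mem_univ i) h
    rw [h1, proj_apply_of_mem W π hπmem hπsum hπid hnon φ (hπmem i v), hφ _ (hπmem i v)]
  have hsub : (⟨π i (φ v), hπmem i (φ v)⟩ : W i) = c • ⟨π i v, hπmem i v⟩ := Subtype.ext hπφ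
  rw [hsub, map_smul, Submodule.coe_smul_of_tower, hφ _ (T i ⟨π i v, hπmem i v⟩).2]

omit [DecidableEq ι] in
/-- **THE BLOCK ALGEBRA REALISES EVERY BLOCK-DIAGONAL ENDOMORPHISM** ((C1) ∧ (C2) ⇒ (C3)): for simple, pairwise
non-isomorphic blocks, every family `T i : Module.End ℂ (W i)` is the action of one element of `R`. -/
theorem blockAlgebra_realises [∀ i, IsSimpleModule R (W i)] (hπmem : ∀ i v, π i v ∈ W i)
    (hπsum : ∀ v, ∑ i, π i v = v) (hπid : ∀ i, ∀ w ∈ W i, π i w = w)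
    (hπzero : ∀ i j, i ≠ j → ∀ w ∈ W j, π i w = 0) (hnon : ∀ i j, i ≠ j → IsEmpty ((W i) ≃ₗ[R] (W j)))
    (T : ∀ i, Module.End ℂ (W i)) : ∃ r : R, ∀ i, ∀ w (hw : w ∈ W i), r • w = (T i ⟨w, hw⟩ : V) := by
  classical
  -- `V` is semisimple over `R`: a sum of simple submodules
  haveI : IsSemisimpleModule R V := by
    refine isSemisimpleModule_of_isSemisimpleModule_submodule (s := Set.univ) (p := W) (fun i _ => inferInstance) ?_
    rw [eq_top_iff]
    intro v _
    rw [← hπsum v]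
    exact Submodule.sum_mem _ fun i _ => Submodule.mem_iSup_of_mem i (Submodule.mem_iSup_of_mem trivial (hπmem i v))
  -- the block-diagonal map is `End R V`-linear
  let f : V →ₗ[Module.End R V] V :=
    { toFun := blockMap W π hπmem T
      map_add' := fun a b => by rw [map_add]
      map_smul' := fun φ v => by
        simp only [RingHom.id_apply, Module.End.smul_def]
        exact blockMap_comm W π hπmem hπsum hπid hnon T φ v }
  -- density on a ℂ-basis
  let b := Module.finBasis ℂ V
  obtain ⟨r, hr⟩ := jacobson_density f (Finset.univ.image b)
  have hmaps : blockMap W π hπmem T = DistribSMul.toLinearMap ℂ V r := by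
    refine b.ext fun k => ?_
    have := hr (b k) (Finset.mem_image_of_mem b (Finset.mem_univ k))
    rw [DistribSMul.toLinearMap_apply]
    exact this
  have hall : ∀ v, blockMap W π hπmem T v = r • v := fun v => by
    rw [hmaps, DistribSMul.toLinearMap_apply]
  refine ⟨r, fun i w hw => ?_⟩
  rw [← hall w, blockMap_apply_of_mem W π hπmem hπid hπzero T hw]

end Blocks

end JacobsonBlock

end Summit.Ventures.HodgeRepro.Tier4.Line1

end
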